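import Summits.Schanuel.Schanuel.Theorems.ZilberEacParamSurfaceEdge
import Summits.Schanuel.Schanuel.Theorems.ZilberEacParamSurfaceCert
import Summits.Schanuel.Schanuel.Theorems.ZilberEacParamCurveEdge
import HarnessLib

/-!
# Polynomially parametrised base curves, XII: Zariski density of the exponential points of the
# NON-SPLIT surfaces `{(g(t), y) : Q(t; y₀, y₁) = 0}` — balanced edges, `t`-equidegree `Q`

HONEST FRAMING.  Cell `pub-schanuel` (Zilber's Exponential-Algebraic Closedness, case ladder;
host summit Schanuel), seat 2, gen 19.  We answer Mantova–Masser's "unprojected density"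
question (PLMS 129 (2024) §1 p. 5; OPEN in general) on NON-SPLIT surfaces over a polynomially
parametrised base curve `C = g(ℂ)`:

  `S(g; Q) = {(g₀(t), g₁(t), y₀, y₁) : Q(t; y₀, y₁) = 0} ⊆ ℂ² × ℂ²`, `Q ∈ ℂ[t, y₀, y₁]` irreducible
  (the fibre curve MOVES with the parameter), `1 ≤ deg g₀ < deg g₁`,

when the lower-left edge of the `y`-support of `Q` is BALANCED (`unprojectedDense_paramSurface₃_of_edge`),
in particular for every `Q` that is `t`-equidegree on its `y`-support
(`unprojectedDense_paramSurface₃_of_equidegree`: two `y₁`-degrees, all monomials of `t`-degree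
`≤ N`, every `y`-monomial occurring with `t^N` — e.g. `Q` of full support in a box).  This is the
analogue over polynomial curves of gen 16's theorem 12.38 over graphs; the UNBALANCED edges (gen
17's logarithmic balance) and the dictionary lemma for abstract `W` of the case over `C` are left
OPEN here.  NOT Schanuel's conjecture (neither used nor implied; EAC ⇏ SC); `EC(3,2)` stays OPEN.

Proof: file X (escaping zeros for a balanced edge, engine IX) + file XI (certificate) + THEOREM G.
-/

noncomputable section

open Filter Topology Metric Set Complex MvPolynomial
open Literature.NumberTheory.Transcendental Literature.ModelTheory.Zilber
open Literature.ModelTheory.ExponentialFields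

set_option linter.dupNamespace false

namespace Summit.Schanuel.Schanuel.Theorems

/-! ## Part A. Density from escaping exponential points -/

/-- **Density from escaping exponential points** (non-split surfaces over a polynomial curve).
(new) -/
theorem unprojectedDense_paramSurface₃_of_expPoints (g₀ g₁ : Polynomial ℂ)
    (Q : MvPolynomial (Fin 3) ℂ) {t : ℕ → ℂ}
    (ht : ∀ k, MvPolynomial.eval ![t k, exp (g₀.eval (t k)), exp (g₁.eval (t k))] Q = 0)
    (hgr : Tendsto (fun k => |(g₀.eval (t k)).re| / Real.log (2 + ‖g₀.eval (t k)‖)) atTop atTop)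
    (hS : IsIrreducibleClosed ℂ {w : Fin 2 ⊕ Fin 2 → ℂ | ∃ t : ℂ, w (Sum.inl 0) = g₀.eval t ∧
      w (Sum.inl 1) = g₁.eval t ∧
      MvPolynomial.eval (Fin.cases t (fun i => w (Sum.inr i)) : Fin 3 → ℂ) Q = 0})
    (hdim : zariskiDim ℂ {w : Fin 2 ⊕ Fin 2 → ℂ | ∃ t : ℂ, w (Sum.inl 0) = g₀.eval t ∧
      w (Sum.inl 1) = g₁.eval t ∧
      MvPolynomial.eval (Fin.cases t (fun i => w (Sum.inr i)) : Fin 3 → ℂ) Q = 0} ≤ (2 : ℕ)) :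
    UnprojectedDense {w : Fin 2 ⊕ Fin 2 → ℂ | ∃ t : ℂ, w (Sum.inl 0) = g₀.eval t ∧
      w (Sum.inl 1) = g₁.eval t ∧
      MvPolynomial.eval (Fin.cases t (fun i => w (Sum.inr i)) : Fin 3 → ℂ) Q = 0} := by
  set q : ℕ → Fin 2 ⊕ Fin 2 → ℂ := fun k =>
    Sum.elim ![g₀.eval (t k), g₁.eval (t k)] ![exp (g₀.eval (t k)), exp (g₁.eval (t k))] with hq
  have hqS : ∀ k, q k ∈ {w : Fin 2 ⊕ Fin 2 → ℂ | ∃ t : ℂ, w (Sum.inl 0) = g₀.eval t ∧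
      w (Sum.inl 1) = g₁.eval t ∧
      MvPolynomial.eval (Fin.cases t (fun i => w (Sum.inr i)) : Fin 3 → ℂ) Q = 0} := by
    intro k
    refine ⟨t k, by simp [hq], by simp [hq], ?_⟩
    have e : (Fin.cases (t k) (fun i => q k (Sum.inr i)) : Fin 3 → ℂ) =
        ![t k, exp (g₀.eval (t k)), exp (g₁.eval (t k))] := by
      funext i
      refine Fin.cases ?_ (fun j => ?_) i
      · rfl
      · simp only [Fin.cases_succ]
        fin_cases j <;> simp [hq]
    rw [e]; exact ht k
  have hqΓ : ∀ k, q k ∈ expGraph ℂ 2 := by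
    intro k
    rw [mem_expGraph_iff]
    intro i
    rw [Literature.ModelTheory.ExponentialFields.ExponentialRing.complex_exp_eq]
    fin_cases i <;> simp [hq]
  have hgr' : Tendsto (fun k => |(q k (Sum.inl 0)).re| / Real.log (2 + ‖q k (Sum.inl 0)‖))
      atTop atTop := by
    refine hgr.congr fun k => ?_
    simp [hq]
  exact unprojectedDense_of_growth hS hdim 0 hqS hqΓ hgr'

/-! ## Part B. Density: balanced edge; `t`-equidegree `Q` -/

section Main

variable (g₀ g₁ : Polynomial ℂ) {Q : MvPolynomial (Fin 3) ℂ}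

/-- **Density for a balanced edge (unequal degrees `1 ≤ deg g₀ < deg g₁`).**  `Q` irreducible,
`(s, m_b)` lower-left edge data of the `y`-support with top `t`-degree `n` on the edge whose edge
polynomial is nonzero with a root `θ ≠ 0` ⟹ the exponential points of `S(g; Q)` are Zariski dense.
[cite: MantovaMasser2023, §1 Further remarks, p. 5 (the question, open in general)] (new) -/
theorem unprojectedDense_paramSurface₃_of_edge (hg₀ : 1 ≤ g₀.natDegree)
    (hlt : g₀.natDegree < g₁.natDegree) (hirr : Irreducible Q)
    {s : ℝ} {mb : Fin 3 →₀ ℕ}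
    (hE1 : ∀ m ∈ Q.support, ((mb 1 : ℝ) - s * mb 2) ≤ (m 1 : ℝ) - s * m 2)
    (hE2 : ∀ m ∈ Q.support, ((m 1 : ℝ) - s * m 2) = (mb 1 : ℝ) - s * mb 2 → mb 2 ≤ m 2)
    (n : ℕ)
    (hn : ∀ m ∈ Q.support, ((m 1 : ℝ) - s * m 2) = (mb 1 : ℝ) - s * mb 2 → m 0 ≤ n)
    {θ : ℂ} (hθ0 : θ ≠ 0)
    (hθ : (∑ m ∈ Q.support.filter
        (fun m : Fin 3 →₀ ℕ => ((m 1 : ℝ) - s * m 2) = (mb 1 : ℝ) - s * mb 2),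
        Polynomial.C ((Polynomial.C (Q.coeff m) * Polynomial.X ^ (m 0)).coeff n) *
          Polynomial.X ^ (m 2 - mb 2)).eval θ = 0)
    (hQt : (∑ m ∈ Q.support.filter
        (fun m : Fin 3 →₀ ℕ => ((m 1 : ℝ) - s * m 2) = (mb 1 : ℝ) - s * mb 2),
        Polynomial.C ((Polynomial.C (Q.coeff m) * Polynomial.X ^ (m 0)).coeff n) *
          Polynomial.X ^ (m 2 - mb 2)) ≠ 0) :
    UnprojectedDense {w : Fin 2 ⊕ Fin 2 → ℂ | ∃ t : ℂ, w (Sum.inl 0) = g₀.eval t ∧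
      w (Sum.inl 1) = g₁.eval t ∧
      MvPolynomial.eval (Fin.cases t (fun i => w (Sum.inr i)) : Fin 3 → ℂ) Q = 0} := by
  obtain ⟨hdR, ω, σ, hσ, hω, hre⟩ := paramCurve_dir_of_lt g₀ g₁ hg₀ hlt s
  obtain ⟨t, ht, hgr⟩ := exists_paramSurface_expPoints_of_edge g₀ g₁ hg₀ Q hE1 hE2 n hn hθ0 hθ
    hQt hdR hσ hω hre
  exact unprojectedDense_paramSurface₃_of_expPoints g₀ g₁ Q ht hgr
    (isIrreducibleClosed_paramSurface₃ g₀ g₁ hg₀ hirr)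
    (by rw [zariskiDim_paramSurface₃ g₀ g₁ hg₀ hirr])

/-- **Density for `t`-equidegree `Q` (unequal degrees `1 ≤ deg g₀ < deg g₁`).**  `Q ∈ ℂ[t, y₀, y₁]`
irreducible with two monomials of different `y₁`-degree, all monomials of `t`-degree `≤ N`, and every
`y`-monomial of `Q` occurring with `t^N` ⟹ the exponential points of
`S(g; Q) = {(g(t), y) : Q(t; y) = 0}` are Zariski dense — in general a NON-SPLIT surface over the
polynomial curve `C = g(ℂ)`. [cite: MantovaMasser2023, §1 Further remarks, p. 5 (the question, open
in general)] (new) -/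
theorem unprojectedDense_paramSurface₃_of_equidegree (hg₀ : 1 ≤ g₀.natDegree)
    (hlt : g₀.natDegree < g₁.natDegree) (hirr : Irreducible Q)
    (h2 : ∃ m ∈ Q.support, ∃ m' ∈ Q.support, m 2 ≠ m' 2) (N : ℕ)
    (hN : ∀ m ∈ Q.support, m 0 ≤ N)
    (htop : ∀ m ∈ Q.support, ∃ m' ∈ Q.support, m' 0 = N ∧ m' 1 = m 1 ∧ m' 2 = m 2) :
    UnprojectedDense {w : Fin 2 ⊕ Fin 2 → ℂ | ∃ t : ℂ, w (Sum.inl 0) = g₀.eval t ∧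
      w (Sum.inl 1) = g₁.eval t ∧
      MvPolynomial.eval (Fin.cases t (fun i => w (Sum.inr i)) : Fin 3 → ℂ) Q = 0} := by
  classical
  obtain ⟨s, mb, hmb, hE1, hE2, ms, hmsA, hms2, hmsw⟩ := exists_lowerLeft_edge₃ Q.support h2
  set Qt : Polynomial ℂ := ∑ m ∈ Q.support.filter
      (fun m : Fin 3 →₀ ℕ => ((m 1 : ℝ) - s * m 2) = (mb 1 : ℝ) - s * mb 2),
      Polynomial.C ((Polynomial.C (Q.coeff m) * Polynomial.X ^ (m 0)).coeff N) *
        Polynomial.X ^ (m 2 - mb 2) with hQt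
  obtain ⟨mb', hmb'A, hmb'0, hmb'1, hmb'2⟩ := htop mb hmb
  obtain ⟨ms', hms'A, hms'0, hms'1, hms'2⟩ := htop ms hmsA
  have hwb' : ((mb' 1 : ℝ) - s * mb' 2) = (mb 1 : ℝ) - s * mb 2 := by rw [hmb'1, hmb'2]
  have hws' : ((ms' 1 : ℝ) - s * ms' 2) = (mb 1 : ℝ) - s * mb 2 := by rw [hms'1, hms'2, hmsw]
  have hcoef : ∀ m : Fin 3 →₀ ℕ, (Polynomial.C (Q.coeff m) * Polynomial.X ^ (m 0)).coeff N =
      if N = m 0 then Q.coeff m else 0 := fun m => by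
    rw [Polynomial.coeff_C_mul, Polynomial.coeff_X_pow]; split_ifs <;> simp
  have hQ0 : Qt.eval 0 = Q.coeff mb' := by
    rw [hQt, Polynomial.eval_finsetSum, Finset.sum_eq_single mb']
    · rw [hcoef, if_pos hmb'0.symm, hmb'2]; simp
    · intro m hm hne
      obtain ⟨hmA, hmw⟩ := Finset.mem_filter.1 hm
      rw [hcoef]
      by_cases h0 : N = m 0
      · rw [if_pos h0]
        have hlt' : mb 2 < m 2 := by
          rcases (hE2 m hmA hmw).lt_or_eq with h | h
          · exact h
          · exfalso
            exact hne (gse_eq_of_weight_eq (hmw.trans hwb'.symm) (h.symm.trans hmb'2.symm)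
              (h0.symm.trans hmb'0.symm))
        have hpos : m 2 - mb 2 ≠ 0 := by omega
        simp [zero_pow hpos]
      · rw [if_neg h0]; simp
    · intro h
      exact (h (Finset.mem_filter.2 ⟨hmb'A, hwb'⟩)).elim
  have hQ0' : Qt.eval 0 ≠ 0 := by rw [hQ0]; exact MvPolynomial.mem_support_iff.1 hmb'A
  have hlt2 : mb 2 < ms 2 := lt_of_le_of_ne (hE2 ms hmsA hmsw) (Ne.symm hms2)
  have hQd : 0 < Qt.natDegree := by
    refine lt_of_lt_of_le (by omega : 0 < ms 2 - mb 2) (Polynomial.le_natDegree_of_ne_zero ?_)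
    rw [hQt, Polynomial.finsetSum_coeff, Finset.sum_eq_single ms']
    · rw [hcoef, if_pos hms'0.symm, Polynomial.coeff_C_mul, Polynomial.coeff_X_pow, hms'2,
        if_pos rfl, mul_one]
      exact MvPolynomial.mem_support_iff.1 hms'A
    · intro m hm hne
      obtain ⟨hmA, hmw⟩ := Finset.mem_filter.1 hm
      rw [hcoef, Polynomial.coeff_C_mul, Polynomial.coeff_X_pow]
      by_cases h0 : N = m 0
      · rw [if_pos h0, if_neg]
        · simp
        · intro h
          have hle := hE2 m hmA hmw
          have h2' : m 2 = ms' 2 := by rw [hms'2]; omega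
          exact hne (gse_eq_of_weight_eq (hmw.trans hws'.symm) h2' (h0.symm.trans hms'0.symm))
      · rw [if_neg h0]; simp
    · intro h
      exact (h (Finset.mem_filter.2 ⟨hms'A, hws'⟩)).elim
  obtain ⟨θ, hθ⟩ := Complex.exists_root (Polynomial.natDegree_pos_iff_degree_pos.1 hQd)
  have hθ0 : θ ≠ 0 := by
    rintro rfl
    exact hQ0' hθ
  exact unprojectedDense_paramSurface₃_of_edge g₀ g₁ hg₀ hlt hirr hE1 hE2 N
    (fun m hm _ => hN m hm) hθ0 hθ (Polynomial.ne_zero_of_natDegree_gt hQd)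

end Main

end Summit.Schanuel.Schanuel.Theorems
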